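import Literature.MathematicalPhysics.QuantumLattice.HardCoreBosonBECPhaseNoGap
import Literature.MathematicalPhysics.QuantumLattice.HardCoreBosonGroundStateBEC
import HarnessLib

/-!
# Hard-core lattice bosons on `ℤ²` in a weak staggered field: no gap and no cusp in the GROUND STATE
# (Aizenman–Lieb–Seiringer–Solovej–Yngvason 2004 §4 "No cusp, no gap" in the two-dimensional BEC phase)

Topic `MathematicalPhysics/QuantumLattice`; the two-dimensional leg of `HardCoreBosonBECPhaseNoGap.lean`.  That file
formalises §4 of M. Aizenman, E. H. Lieb, R. Seiringer, J. P. Solovej, J. Yngvason, Phys. Rev. A **70** (2004) 023612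
for the hard-core lattice gas `hardCoreLatticeGas d L λ = -Σ_⟨xy⟩(S¹_xS¹_y + S²_xS²_y) + λΣ_x(½ + (-1)^xS³_x)` on the
even torus:

> "The system is in a Mott insulator state at zero temperature if a finite change in the chemical potential is
> required to change the particle number in the ground state … a gap means that, for all `k`,
> `E_{-k} + E_k - 2E_0 ≥ c|k|` (eq:gap) … In this section we will show that whenever there is BEC then (eq:gap) fails.
> In fact, we will prove that `E_k - E_0 ≤ c_k/|Λ|` (nogap) … we prove that (eq:gap) fails for macroscopic `k` as
> well … we obtain as an upper bound for the ground state energy of `H - μS³_tot` `E_0(1-|Λ|^{-1}) + ½λ - cμ²|Λ|` for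
> small `μ`, with `c > 0` in the case of BEC. By taking a Legendre transform, we arrive at (nocusp)."

and §2: "Bose–Einstein condensation … for small `λ` … For `d = 2` this is true only in the ground state".
`HardCoreBosonBECPhaseNoGap.lean` proves (nogap), (nocusp) and the failure of (eq:gap) at macroscopic `k`
unconditionally for `d ≥ 3` in the window `[d(d+1)+4λ²]c_d² < 4` and, for every `d`, CONDITIONALLY on a ground-state
condensate floor `q|Λ|² ≤ Σ_{x,y}⟨Φ,(S¹_xS¹_y + S²_xS²_y)Φ⟩`
(`hardCoreLatticeGas_lowestEnergyInSector_sub_groundEnergy_le`, `hardCoreLatticeGas_noCusp_grandCanonical`,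
`hardCoreLatticeGas_noCusp_canonical`); its docstring: "`d = 2` (no reflection-positivity BEC proof at `λ > 0`) is
covered only by the conditional §5/§9/§10 statements".  The tree now PROVES the two-dimensional ground-state floor —
`HardCoreBosonGroundStateBEC.lean`, `hardCoreLatticeGas_groundState_lro_ge_two`: for `0 ≤ λ ≤ 1/40` there is `k₀`
with `Σ_{x,y}⟨Φ,(S¹S¹+S²S²)Φ⟩ ≥ |Λ|²/500` for every normalised ground vector on every even torus `(ℤ/2kℤ)²`, `k ≥ k₀`
(Kennedy–Lieb–Shastry's Gaussian-domination route at `β → ∞`) — so the conditional statements become theorems in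
`d = 2`.  This file records them.

## What this file proves (0 definitions, 0 named facts, 0 sorry)

All for `d = 2`, `0 ≤ λ ≤ 1/40`, along the even tori `Λ_k = (ℤ/2kℤ)²`, `|Λ_k| = 4k²`, `k ≥ k₀`:
* `hardCoreLatticeGas_two_groundState_condensate_floor` — the floor in the form the conditional theorems consume:
  `(1/500)|Λ|² ≤ Σ_{x,y}⟨Φ,(S¹S¹+S²S²)Φ⟩` for every normalised ground vector `Φ`.
* **`hardCoreLatticeGas_two_noGap`** — (nogap): for every `m ≥ 1` there are `c_m` and `k₀` with: the sector of
  `|Λ|/2 + m` bosons is nonempty and `E_m - E_0 ≤ c_m/|Λ|` (explicitly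
  `c_m = 2^m m²((m-1)(4+|λ|) + 16+2|λ|)·500^m`).
* **`hardCoreLatticeGas_two_noCusp`** — (nocusp), finite-volume grand-canonical and canonical forms: `∃ c > 0, k₀` with,
  for every `|μ| ≤ 1`, `E_GS(H - μS³_tot) ≤ E₀(1 - |Λ|⁻¹) + λ/2 - cμ²|Λ|` and a particle-number sector `M` with
  `E_M - μM ≤` the same.
* **`hardCoreLatticeGas_two_gap_fails_macroscopic`** — for every `c' > 0` there are `ρ > 0`, `k₀` with, on every
  `Λ_k`, `k ≥ k₀`, a sector `M ≥ ρ|Λ|` having `E_M - E_0 < c'M`: (eq:gap) fails at macroscopic particle numbers.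
So in the two-dimensional ground state at weak staggered field the half-filled hard-core gas is a compressible
condensate, not a Mott insulator — the zero-temperature counterpart of the fact that at `T > 0` there is no
condensation in `d = 2` at all.

WHAT THIS IS NOT: the proofs are those of `HardCoreBosonBECPhaseNoGap.lean` (the source's trial states `(S⁺_tot)^k|0⟩`
and `e^{iεS²_tot}(S¹_y+½)|0⟩`) fed with the two-dimensional floor; nothing new is claimed about the method.  The
thermodynamic-limit phrasing of (nocusp) (`0 ≤ e_∞(ρ) - e_∞(½) ≤ const(ρ-½)²`, existence of `e_∞`) is not formalised;
the Mott phase (large `λ`, Theorem 2 of the source) is not touched; nothing here is about the Hubbard model.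

## References
* [AizenmanEtAl2004] M. Aizenman, E. H. Lieb, R. Seiringer, J. P. Solovej, J. Yngvason, Phys. Rev. A **70** (2004)
  023612 = arXiv:cond-mat/0403240, §2 (the `d = 2` remark), §4 (eq:gap), (nogap), (nocusp) (pp. 9–10 of the arXiv
  version), display after Lemma 2 ((11.24)).
* [LSSY2005] E. H. Lieb, R. Seiringer, J. P. Solovej, J. Yngvason, *The Mathematics of the Bose Gas and its
  Condensation*, Birkhäuser 2005, Ch. 11 (11.24), (11.28)–(11.30).
* [KLS1988PRL] T. Kennedy, E. H. Lieb, B. S. Shastry, Phys. Rev. Lett. **61** (1988) 2582–2584, eqs. (5)–(8).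
-/

noncomputable section

open Filter Topology Matrix Complex Finset WithLp
open Literature.MathematicalPhysics.QuantumLattice Literature.MathematicalPhysics.QuantumLattice.SpinOperators
  Literature.Probability.LatticeModels Literature.Barriers.AtomisticToContinuum.BoseGas
open scoped ComplexOrder ComplexConjugate Matrix.Norms.L2Operator InnerProductSpace

namespace Literature.MathematicalPhysics.QuantumLattice

namespace HardCoreTwoDim

/-! ### §0. Two elementary lemmas (as in `HardCoreBosonBECPhaseNoGap.lean`, where they are private) -/

/-- A nonzero vector has a real multiple of unit norm. [folklore] -/
private theorem exists_real_smul_unit {m : Type*} [Fintype m] {v : m → ℂ} (hv : v ≠ 0) :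
    ∃ c : ℝ, star ((c : ℂ) • v) ⬝ᵥ ((c : ℂ) • v) = 1 := by
  set r : ℝ := ‖(toLp 2 v : EuclideanSpace ℂ m)‖ ^ 2 with hr
  have hvv : star v ⬝ᵥ v = (r : ℂ) := by rw [star_dotProduct_self_eq_norm_sq, hr, Complex.ofReal_pow]
  have hr0 : 0 < r := by
    have : (toLp 2 v : EuclideanSpace ℂ m) ≠ 0 := fun h => hv (by simpa using congrArg ofLp h)
    positivity
  refine ⟨(Real.sqrt r)⁻¹, ?_⟩
  have h1 : (Real.sqrt r)⁻¹ * (Real.sqrt r)⁻¹ * r = 1 := by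
    rw [← mul_inv, Real.mul_self_sqrt hr0.le, inv_mul_cancel₀ hr0.ne']
  rw [star_smul, smul_dotProduct, dotProduct_smul, hvv, Complex.star_def, Complex.conj_ofReal, smul_eq_mul,
    smul_eq_mul, ← mul_assoc, ← Complex.ofReal_mul, ← Complex.ofReal_mul, h1, Complex.ofReal_one]

/-- `E_GS(A) ≤ min_K Re⟨ψ,Aψ⟩` for a nonempty subspace `K` (variational principle). [cite: Tasaki2020, §2.1 (2.1.6)] -/
private theorem groundEnergy_le_minEnergyOn {ι : Type*} [Fintype ι] [DecidableEq ι] {A : Matrix ι ι ℂ}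
    (hA : A.IsHermitian) {K : Submodule ℂ (ι → ℂ)} (hK : K ≠ ⊥) : A.groundEnergy ≤ A.minEnergyOn K := by
  obtain ⟨v, hvK, hv0⟩ := Submodule.exists_mem_ne_zero_of_ne_bot hK
  obtain ⟨c, hc⟩ := exists_real_smul_unit hv0
  unfold Matrix.minEnergyOn
  refine le_csInf ⟨_, (c : ℂ) • v, K.smul_mem _ hvK, hc, rfl⟩ ?_
  rintro E ⟨ψ, -, hψ1, rfl⟩
  exact Matrix.groundEnergy_le_rayleigh_holds hA ψ hψ1

/-- `|Λ_k| = |(ℤ/2kℤ)²| = (2k)²`. [folklore] -/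
private theorem card_two (k : ℕ) [NeZero (2 * k)] :
    (Fintype.card (TorusSite 2 (2 * k)) : ℝ) = ((2 * k : ℕ) : ℝ) ^ 2 := by
  rw [Literature.Probability.LatticeModels.card_torusSite 2 (2 * k), Nat.cast_pow]

/-! ### §1. The two-dimensional ground-state condensate floor in the consumable form -/

/-- **The two-dimensional ground-state condensate floor** (tree `hardCoreLatticeGas_groundState_lro_ge_two`, here with
`|Λ|² = ((2k)²)²` spelled as `(Fintype.card Λ)²` and the constant as a factor): for `0 ≤ λ ≤ 1/40` there is `k₀` such
that on every even torus `(ℤ/2kℤ)²`, `k ≥ k₀`, every normalised ground vector `Φ` of `hardCoreLatticeGas 2 (2k) λ` has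
`(1/500)|Λ|² ≤ Σ_{x,y}Re⟨Φ,(S¹_xS¹_y + S²_xS²_y)Φ⟩` ("Since there is BEC, `⟨(S⁻_tot)(S⁺_tot)⟩ ≥ c'|Λ|²`").
[cite: AizenmanEtAl2004, §2 ("For d = 2 this is true only in the ground state"), §4 ("Since there is BEC")]
[cite: KLS1988PRL, eqs. (5)–(8)] -/
theorem hardCoreLatticeGas_two_groundState_condensate_floor {lam : ℝ} (hlam : 0 ≤ lam) (hlam' : lam ≤ 1 / 40) :
    ∃ k₀ : ℕ, ∀ k : ℕ, k₀ ≤ k → ∀ [NeZero (2 * k)],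
      ∀ Φ : TensorIndex (TorusSite 2 (2 * k)) 2 → ℂ, Φ ∈ (hardCoreLatticeGas 2 (2 * k) lam).groundSpace →
        star Φ ⬝ᵥ Φ = 1 →
        (1 / 500 : ℝ) * (Fintype.card (TorusSite 2 (2 * k)) : ℝ) ^ 2 ≤
          ∑ x : TorusSite 2 (2 * k), ∑ y : TorusSite 2 (2 * k),
            (star Φ ⬝ᵥ ((siteSpin 1 x 0 * siteSpin 1 y 0 + siteSpin 1 x 1 * siteSpin 1 y 1) *ᵥ Φ)).re := by
  obtain ⟨k₀, hk₀⟩ := hardCoreLatticeGas_groundState_lro_ge_two hlam hlam'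
  refine ⟨k₀, fun k hk _ Φ hΦ hΦ1 => ?_⟩
  have h := hk₀ k hk Φ hΦ hΦ1
  rw [card_two]
  linarith

/-! ### §2. (nogap) in the two-dimensional ground state -/

/-- **ALSSY (nogap) ON `ℤ²`: in the two-dimensional ground-state BEC phase there is no gap for adding particles beyond
half filling.**  For `0 ≤ λ ≤ 1/40` and every `m ≥ 1` there are a constant `c_m` (here
`2^m m²((m-1)(4+|λ|) + 16+2|λ|)·500^m`, independent of `Λ`) and `k₀` such that on every even torus `Λ = (ℤ/2kℤ)²`,
`k ≥ k₀`, the lowest energy `E_m` of the hard-core lattice gas with `|Λ|/2 + m` particles (sector `S³_tot = m`,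
nonempty) satisfies `E_m - E_0 ≤ c_m/|Λ|` — so the Mott-gap inequality (eq:gap) `E_{-m} + E_m - 2E_0 ≥ c|m|` fails for
every finite `m`. [cite: AizenmanEtAl2004, §4 eq. (nogap), §2] [cite: LSSY2005, Ch. 11 (11.28)] -/
theorem hardCoreLatticeGas_two_noGap {lam : ℝ} (hlam : 0 ≤ lam) (hlam' : lam ≤ 1 / 40) {m : ℕ} (hm : 1 ≤ m) :
    ∃ c : ℝ, ∃ k₀ : ℕ, ∀ k : ℕ, k₀ ≤ k → ∀ [NeZero (2 * k)],
      spinZSector (Λ := TorusSite 2 (2 * k)) 1 (m : ℝ) ≠ ⊥ ∧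
        lowestEnergyInSector 1 (hardCoreLatticeGas 2 (2 * k) lam) m -
            (hardCoreLatticeGas 2 (2 * k) lam).groundEnergy ≤
          c / Fintype.card (TorusSite 2 (2 * k)) := by
  obtain ⟨k₀, hk₀⟩ := hardCoreLatticeGas_two_groundState_condensate_floor hlam hlam'
  set q : ℝ := 1 / 500 with hq
  have hq0 : 0 < q := by norm_num
  obtain ⟨M, hM⟩ := exists_nat_gt (2 * (((m : ℝ) - 1) * m) / q)
  refine ⟨(2 : ℝ) ^ m * (m : ℝ) ^ 2 * (((m : ℝ) - 1) * (2 * (2 : ℕ) + |lam|) + (8 * (2 : ℕ) + 2 * |lam|)) / q ^ m,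
    max k₀ (max M 2), fun k hk _ => ?_⟩
  have hk₀k : k₀ ≤ k := le_trans (le_max_left _ _) hk
  have hMk : M ≤ k := le_trans (le_max_left _ _) (le_trans (le_max_right _ _) hk)
  have hk2 : 2 ≤ k := le_trans (le_max_right _ _) (le_trans (le_max_right _ _) hk)
  have hLe : Even (2 * k) := even_two_mul k
  have h3 : 3 ≤ 2 * k := by omega
  -- a unit ground-state vector and its condensate floor
  obtain ⟨ψ, hψ0, hψ, -⟩ :=
    HardCoreBoson.exists_groundState_totalSpin_eq_zero (d := 2) (L := 2 * k) two_pos hLe lam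
  obtain ⟨c, hc⟩ := exists_real_smul_unit hψ0
  have hΦ : (c : ℂ) • ψ ∈ (hardCoreLatticeGas 2 (2 * k) lam).groundSpace := Submodule.smul_mem _ _ hψ
  have hlro := hk₀ k hk₀k ((c : ℂ) • ψ) hΦ hc
  -- the size condition `2(m-1)m ≤ q|Λ|²`
  set N : ℝ := ((Fintype.card (TorusSite 2 (2 * k)) : ℕ) : ℝ) with hN
  have hN1 : 1 ≤ N := by
    have : 1 ≤ Fintype.card (TorusSite 2 (2 * k)) := Fintype.card_pos
    rw [hN]; exact_mod_cast this
  have hNk : (k : ℝ) ≤ N := by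
    rw [hN, card_two]
    push_cast
    have hk' : (2 : ℝ) ≤ k := by exact_mod_cast hk2
    nlinarith
  have hbig : 2 * (((m : ℝ) - 1) * m) ≤ q * N ^ 2 := by
    have h1 : 2 * (((m : ℝ) - 1) * m) / q < M := hM
    rw [div_lt_iff₀ hq0] at h1
    have h2 : (M : ℝ) ≤ N := le_trans (by exact_mod_cast hMk) hNk
    have h3 : (M : ℝ) * q ≤ N * q := mul_le_mul_of_nonneg_right h2 hq0.le
    have h4 : 0 ≤ q * N * (N - 1) := mul_nonneg (mul_nonneg hq0.le (by linarith)) (by linarith)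
    nlinarith
  obtain ⟨hne, hE⟩ := hardCoreLatticeGas_lowestEnergyInSector_sub_groundEnergy_le (2 * k) two_pos hLe h3 lam hΦ hc
    hq0 hlro hm hbig
  refine ⟨hne, hE.trans (le_of_eq ?_)⟩
  rw [div_div, Nat.cast_ofNat]

/-! ### §3. (nocusp) and the failure of (eq:gap) at macroscopic particle numbers, `d = 2` -/

/-- **ALSSY (nocusp) ON `ℤ²`** (finite-volume grand-canonical and canonical forms): for `0 ≤ λ ≤ 1/40` there are `c > 0`
(here `c = q²/(2(4 + |λ|/2 + ½))`, `q = 1/500`) and `k₀` such that on every even torus `Λ = (ℤ/2kℤ)²`, `k ≥ k₀`, and for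
every `|μ| ≤ 1`: `E_GS(H - μS³_tot) ≤ E₀(1 - |Λ|⁻¹) + λ/2 - cμ²|Λ|` ("we obtain as an upper bound for the ground state
energy of `H - μS³_tot` `E_0(1-|Λ|^{-1}) + ½λ - cμ²|Λ|` … with `c > 0` in the case of BEC"), and (Legendre transform)
some particle-number sector `M` has `E_M - μM ≤ E₀(1 - |Λ|⁻¹) + λ/2 - cμ²|Λ|`.
[cite: AizenmanEtAl2004, §4 (nocusp), §2] [cite: LSSY2005, Ch. 11 (11.30)] -/
theorem hardCoreLatticeGas_two_noCusp {lam : ℝ} (hlam : 0 ≤ lam) (hlam' : lam ≤ 1 / 40) :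
    ∃ c : ℝ, 0 < c ∧ ∃ k₀ : ℕ, ∀ k : ℕ, k₀ ≤ k → ∀ [NeZero (2 * k)], ∀ μ : ℝ, |μ| ≤ 1 →
      (hardCoreLatticeGas 2 (2 * k) lam - (μ : ℂ) • totalSpin 1 2).groundEnergy ≤
          (hardCoreLatticeGas 2 (2 * k) lam).groundEnergy -
            (hardCoreLatticeGas 2 (2 * k) lam).groundEnergy / Fintype.card (TorusSite 2 (2 * k)) + lam / 2 -
              c * μ ^ 2 * Fintype.card (TorusSite 2 (2 * k)) ∧
        ∃ M : ℝ, spinZSector (Λ := TorusSite 2 (2 * k)) 1 M ≠ ⊥ ∧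
          lowestEnergyInSector 1 (hardCoreLatticeGas 2 (2 * k) lam) M - μ * M ≤
            (hardCoreLatticeGas 2 (2 * k) lam).groundEnergy -
              (hardCoreLatticeGas 2 (2 * k) lam).groundEnergy / Fintype.card (TorusSite 2 (2 * k)) + lam / 2 -
                c * μ ^ 2 * Fintype.card (TorusSite 2 (2 * k)) := by
  obtain ⟨k₀, hk₀⟩ := hardCoreLatticeGas_two_groundState_condensate_floor hlam hlam'
  set q : ℝ := 1 / 500 with hq
  have hq0 : 0 < q := by norm_num
  set κ₁ : ℝ := 2 * (2 : ℕ) + |lam| / 2 + 1 / 2 with hκ₁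
  have hκ₁0 : 0 < κ₁ := by positivity
  refine ⟨q ^ 2 / (2 * κ₁), by positivity, max k₀ 2, fun k hk _ μ hμ => ?_⟩
  have hk₀k : k₀ ≤ k := le_trans (le_max_left _ _) hk
  have hk2 : 2 ≤ k := le_trans (le_max_right _ _) hk
  have hLe : Even (2 * k) := even_two_mul k
  have h3 : 3 ≤ 2 * k := by omega
  obtain ⟨ψ, hψ0, hψ, -⟩ :=
    HardCoreBoson.exists_groundState_totalSpin_eq_zero (d := 2) (L := 2 * k) two_pos hLe lam
  obtain ⟨c, hc⟩ := exists_real_smul_unit hψ0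
  have hΦ : (c : ℂ) • ψ ∈ (hardCoreLatticeGas 2 (2 * k) lam).groundSpace := Submodule.smul_mem _ _ hψ
  have hlro := hk₀ k hk₀k ((c : ℂ) • ψ) hΦ hc
  have hκ : 0 < 2 * (2 * ((2 : ℕ) : ℝ) + |lam| / 2 + |μ| / 2) := by positivity
  have hcoef : q ^ 2 / (2 * κ₁) * μ ^ 2 * Fintype.card (TorusSite 2 (2 * k)) ≤
      q ^ 2 / (2 * (2 * ((2 : ℕ) : ℝ) + |lam| / 2 + |μ| / 2)) * μ ^ 2 * Fintype.card (TorusSite 2 (2 * k)) := by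
    have h : q ^ 2 / (2 * κ₁) ≤ q ^ 2 / (2 * (2 * ((2 : ℕ) : ℝ) + |lam| / 2 + |μ| / 2)) :=
      div_le_div_of_nonneg_left (sq_nonneg q) hκ (by rw [hκ₁]; linarith)
    have := mul_le_mul_of_nonneg_right h (by positivity : (0 : ℝ) ≤ μ ^ 2 * Fintype.card (TorusSite 2 (2 * k)))
    nlinarith [this]
  have hGC := hardCoreLatticeGas_noCusp_grandCanonical (2 * k) two_pos hLe h3 lam μ hΦ hc hq0.le hlro
  obtain ⟨M, hM, hCan⟩ := hardCoreLatticeGas_noCusp_canonical (2 * k) two_pos hLe h3 lam μ hΦ hc hq0.le hlro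
  exact ⟨by linarith, M, hM, by linarith⟩

/-- **(eq:gap) fails at macroscopic particle numbers in the two-dimensional ground state**: for `0 ≤ λ ≤ 1/40` and
every candidate gap constant `c' > 0` there are a density `ρ > 0` and `k₀` such that every even torus `(ℤ/2kℤ)²`,
`k ≥ k₀`, has a particle-number sector `M ≥ ρ|Λ|` with `E_M - E_0 < c'M` (from the canonical (nocusp) bound at
`μ = min(1, c'/2)` and the a-priori bound (11.24) `E₀ ≥ (λ/2 - ¼[d(d+1)+4λ²]^{1/2})|Λ|`).
[cite: AizenmanEtAl2004, §4 ((eq:gap), (nocusp): "(eq:gap) fails for macroscopic k as well"), §2]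
[cite: LSSY2005, Ch. 11 (11.24), (11.30)] -/
theorem hardCoreLatticeGas_two_gap_fails_macroscopic {lam : ℝ} (hlam : 0 ≤ lam) (hlam' : lam ≤ 1 / 40)
    {c' : ℝ} (hc' : 0 < c') :
    ∃ ρ : ℝ, 0 < ρ ∧ ∃ k₀ : ℕ, ∀ k : ℕ, k₀ ≤ k → ∀ [NeZero (2 * k)],
      ∃ M : ℝ, spinZSector (Λ := TorusSite 2 (2 * k)) 1 M ≠ ⊥ ∧ ρ * Fintype.card (TorusSite 2 (2 * k)) ≤ M ∧
        lowestEnergyInSector 1 (hardCoreLatticeGas 2 (2 * k) lam) M -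
          (hardCoreLatticeGas 2 (2 * k) lam).groundEnergy < c' * M := by
  obtain ⟨c, hc, k₀, hk₀⟩ := hardCoreLatticeGas_two_noCusp hlam hlam'
  set μ : ℝ := min 1 (c' / 2) with hμdef
  have hμ0 : 0 < μ := lt_min one_pos (by positivity)
  have hμ1 : |μ| ≤ 1 := by rw [abs_of_pos hμ0]; exact min_le_left _ _
  have hμc : μ ≤ c' / 2 := min_le_right _ _
  set B₀ : ℝ := Real.sqrt (((2 : ℕ) : ℝ) * ((2 : ℕ) + 1) + 4 * lam ^ 2) / 4 with hB₀
  have hB₀0 : 0 ≤ B₀ := by positivity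
  obtain ⟨L₁, hL₁⟩ := exists_nat_ge (2 * B₀ / (c * μ ^ 2) + 1)
  refine ⟨c * μ / 2, by positivity, max k₀ (max L₁ 2), fun k hk _ => ?_⟩
  have hk₀k : k₀ ≤ k := le_trans (le_max_left _ _) hk
  have hL₁k : L₁ ≤ k := le_trans (le_max_left _ _) (le_trans (le_max_right _ _) hk)
  have hk2 : 2 ≤ k := le_trans (le_max_right _ _) (le_trans (le_max_right _ _) hk)
  have h3 : 3 ≤ 2 * k := by omega
  obtain ⟨-, M, hM, hle⟩ := hk₀ k hk₀k μ hμ1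
  set N : ℝ := ((Fintype.card (TorusSite 2 (2 * k)) : ℕ) : ℝ) with hNdef
  set E₀ : ℝ := (hardCoreLatticeGas 2 (2 * k) lam).groundEnergy with hE₀
  have hHh := hardCoreLatticeGas_isHermitian 2 (2 * k) lam
  have hcard : N = (((2 * k : ℕ) : ℝ)) ^ 2 := by rw [hNdef, card_two]
  have hN : 0 < N := by rw [hNdef]; exact_mod_cast Fintype.card_pos
  -- `N = (2k)² ≥ k ≥ L₁ ≥ 2B₀/(cμ²) + 1`
  have hNk : (L₁ : ℝ) ≤ N := by
    rw [hcard]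
    push_cast
    have : (L₁ : ℝ) ≤ k := by exact_mod_cast hL₁k
    have hk' : (2 : ℝ) ≤ k := by exact_mod_cast hk2
    nlinarith
  have hNbig : 2 * B₀ / (c * μ ^ 2) + 1 ≤ N := hL₁.trans hNk
  have hNbig' : 2 * B₀ + c * μ ^ 2 ≤ c * μ ^ 2 * N := by
    have := mul_le_mul_of_nonneg_left hNbig (by positivity : (0 : ℝ) ≤ c * μ ^ 2)
    rwa [mul_add, mul_div_cancel₀ _ (by positivity : c * μ ^ 2 ≠ 0), mul_one] at this
  -- the a-priori bound `λ/2 - E₀/N ≤ B₀`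
  have hapr : lam / 2 - E₀ / N ≤ B₀ := by
    have h := hardCoreLatticeGas_groundEnergy_ge (d := 2) (2 * k) h3 lam
    rw [← hcard, ← hE₀, ← hB₀] at h
    rw [sub_le_iff_le_add, ← sub_le_iff_le_add', le_div_iff₀ hN]
    exact h
  -- `E_M ≥ E₀`
  have hEM : E₀ ≤ lowestEnergyInSector 1 (hardCoreLatticeGas 2 (2 * k) lam) M := groundEnergy_le_minEnergyOn hHh hM
  -- so `μM ≥ cμ²N - B₀`, `M ≥ (cμ/2)N`, and `E_M - E₀ ≤ μM + B₀ - cμ²N < c'M`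
  have hμM : c * μ ^ 2 * N - B₀ ≤ μ * M := by linarith
  have hMlow : c * μ / 2 * N ≤ M := by
    have h1 : μ * (c * μ / 2 * N) ≤ μ * M := by nlinarith
    exact le_of_mul_le_mul_left h1 hμ0
  refine ⟨M, hM, hMlow, ?_⟩
  have hMpos : 0 ≤ M := le_trans (by positivity) hMlow
  have hcμ : 0 < c * μ ^ 2 := by positivity
  have hμM' : μ * M ≤ c' / 2 * M := by nlinarith [hμc, hMpos]
  have hc'M : 0 ≤ c' / 2 * M := by positivity
  linarith [hle, hapr, hNbig', hEM]

end HardCoreTwoDim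

end Literature.MathematicalPhysics.QuantumLattice
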